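import Summits.ResolutionOfSingularities.ResolutionOfSingularities.Theorems.EquisingularLiftEquisingularLiftNatCompleteIntersectionLiftNose
import Summits.ResolutionOfSingularities.ResolutionOfSingularities.Theorems.EquisingularLiftEquisingularLiftNatCompleteIntersectionLiftJacobian
import Summits.ResolutionOfSingularities.ResolutionOfSingularities.Theorems.EquisingularLiftEquisingularLiftNatCompleteIntersectionLiftSmooth
import Summits.ResolutionOfSingularities.ResolutionOfSingularities.Theorems.EquisingularLiftEquisingularLiftNatDeterminantalLiftNose
import Literature.AlgebraicGeometry.Resolution.ProjectiveSpaceRegular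
import Literature.AlgebraicGeometry.Resolution.RegularLocalOrder
import Literature.AlgebraicGeometry.Resolution.MarkedIdealsLemmas
import Mathlib.RingTheory.MvPolynomial.EulerIdentity
import HarnessLib

/-!
# [OURS · L1 W4.5(b) · EL♮(3) · D5 HOPEN, (IN-1) JOINT BIRTH, brick (B6)] THE Δ2a TRIPLE OF THE KEY MODEL AT `g x₀`:
# stalk generator, gauge membership, and ORDER EXACTLY `α` downstairs — ★ `KeyForm.keyModel_order_at`

res-L1-w45b-stub-2 g16 (desk RULING R59 2026-08-28T22:28Z: «(B6) = res-L1-w45b-stub-2»; statement VERBATIM — up to moving the binders under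
the statement-level `letI := MvPolynomial.gradedAlgebra …` (no local instance attribute), as res-type-027 did for (B3) — from res-L1-w45b-stub-4 g12's
interface file `L/res-L1-w45b-stub-4/KeyFormSIG.lean` 6e4862d4abec49c6; consumed positionally by stub-4's assembly (B7) of `hBirth`).  Crux
`EquisingularLiftNatThree` = stmt-ResolutionOfSingularities-20148.  OURS; NOT a statement of any manuscript ([Hironaka2017] is a candidate under
adjudication, nothing of it is asserted); AI-written, weaker than expert review.  No `sorry`; standard axioms; DEF-FREE.
`--kind proof --supports stmt-ResolutionOfSingularities-20148 --as helper`.  EL♮(3) is NOT proved here.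

WHAT.  At `g x₀ ∈ D₊(x_{i₀})` (`g = Proj φ : ℙⁿ_k → ℙⁿ_O`): (1) the stalk of the key model `(G̃)~` is generated by the germ `Gst` of `G̃ / x_{i₀}^e`
(✓ `CILift.stalkIdeal_projIdealSheaf_span`, `c = 1`); (2) `Gst ∈ 𝓚_{g x₀}^α` for every `𝓚` with `(G̃)~ ≤ 𝓚^α` (✓ `stalkIdeal_pow`); (3) ★ the image of
`Gst` in `𝒪_{ℙⁿ_k, x₀}` — the germ of `G / x_{i₀}^e`, `G = θG̃` (✓ `CILift.stalkMap_germ_mk₁`) — is NOT in `𝔪_{x₀}^{α+1}`, from the downstairs shape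
`G = ℓh^α U + ℓh R₁ + R₂ ℓj`, `Rᵢ ∈ 𝔭_{x₀}^α`, `ℓh, ℓj ∈ 𝔭_{x₀}` linear, `ℓh ≠ 0`, and ONLY `U ∉ 𝔭_{x₀}` for a possibly INHOMOGENEOUS `U`.

PROOF of (3) — everything inside the REGULAR local ring `S = 𝒪_{ℙⁿ_k, x₀}` (✓ `isRegular_projectiveSpace`) through the ring map
`γ = germ_{x₀} ∘ awayToSection ∘ eval₂(cst, x_j/x_{i₀}) : k[x] → S` (on a form of degree `d`, `γ F` = germ of `F / x_{i₀}^d`, ✓ `DetLift.mk₁_eq_eval₂Hom_frac`):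
`t = γ ℓh ∈ 𝔪 ∖ 𝔪²` (✓ `CILift.germ_mk₁_mem_maximalIdeal_iff`; ✓ `CILift.downstairs_stalk_of_jacobian` at `c = 1`: a non-zero linear form has a non-zero
CONSTANT partial derivative — Euler), `γ(𝔭^α) ⊆ 𝔪^α` (𝔭 is homogeneous: piece by piece).  THE INHOMOGENEOUS `U` (res-L1-w45b-crit-3 / crit-2's caveat,
witnesses `1 − x₀`, `x₀ − x₀²`): `U ∉ 𝔭` gives a graded piece `U_{d₀} ∉ 𝔭`, so `γ U_{d₀}` is a UNIT; cutting the identity in degree `α + d₀`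
(`DirectSum.coe_decompose_mul_add_of_left_mem`) gives `π_{α+d₀} G = ℓh^α U_{d₀} + ℓh·π R₁ + π R₂·ℓj`, whose `γ`-image is `t^α·unit + (element of 𝔪^{α+1})`,
and `t^α·unit ∉ 𝔪^{α+1}` because the order is a valuation on a regular local ring (✓ `mul_not_mem_pow_of_not_mem_pow`); if `α + d₀ ≠ e` the left side is
`γ 0 = 0` — absurd — so `α + d₀ = e`, `π_e G = G`, and `γ G ∉ 𝔪^{α+1}`.  No translation of coordinates, no `k = k̄`, `x₀` need not be closed. [folklore]
-/

set_option linter.dupNamespace false -- mandated namespace `Summit.<Summit>.<Problem>` of this single-conjunct summit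
set_option linter.overlappingInstances false -- signatures carry `[IsDomain O] [IsDiscreteValuationRing O]`

noncomputable section

open CategoryTheory AlgebraicGeometry TopologicalSpace IsLocalRing
open MvPolynomial HomogeneousLocalization
open Literature.AlgebraicGeometry.Resolution

namespace Summit.ResolutionOfSingularities.ResolutionOfSingularities.Cruxes.EquisingularLiftNat.Sections

namespace KeyForm

/-! ## §1 Order bookkeeping in a regular local ring -/

section LocalRing

variable {S : Type} [CommRing S] [IsRegularLocalRing S]

/-- In a regular local ring: `t ∉ 𝔪²` ⟹ `t^a ∉ 𝔪^{a+1}` (the order is a valuation). [cite: ZariskiSamuel1960, Ch. VIII §1 Thm. 1] -/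
theorem pow_not_mem_pow_succ_of_not_mem_sq {t : S} (ht : t ∉ maximalIdeal S ^ 2) (a : ℕ) :
    t ^ a ∉ maximalIdeal S ^ (a + 1) := by
  induction a with
  | zero =>
    intro h
    rw [pow_zero, zero_add, pow_one] at h
    exact (maximalIdeal.isMaximal S).ne_top (Ideal.eq_top_of_isUnit_mem _ h isUnit_one)
  | succ a ih =>
    have h := mul_not_mem_pow_of_not_mem_pow ih ht
    rwa [← pow_succ] at h

/-- In a regular local ring: `t ∉ 𝔪²`, `v` a unit, `r ∈ 𝔪^{a+1}` ⟹ `t^a v + r ∉ 𝔪^{a+1}`. [cite: ZariskiSamuel1960, Ch. VIII §1 Thm. 1] -/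
theorem pow_mul_unit_add_not_mem_pow_succ {t v r : S} (ht : t ∉ maximalIdeal S ^ 2) (hv : IsUnit v) (a : ℕ)
    (hr : r ∈ maximalIdeal S ^ (a + 1)) : t ^ a * v + r ∉ maximalIdeal S ^ (a + 1) := by
  have hv' : v ∉ maximalIdeal S ^ (0 + 1) := by
    intro h
    rw [zero_add, pow_one] at h
    exact (mem_nonunits_iff.mp ((mem_maximalIdeal _).mp h)) hv
  have h1 := mul_not_mem_pow_of_not_mem_pow (pow_not_mem_pow_succ_of_not_mem_sq ht a) hv'
  rw [add_zero] at h1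
  intro h
  apply h1
  have h2 := Ideal.sub_mem _ h hr
  rwa [add_sub_cancel_right] at h2

end LocalRing

/-! ## §2 Graded pieces -/

section Graded

variable {k : Type} [Field k] {n : ℕ}

/-- A non-zero LINEAR form has a partial derivative which is a non-zero constant, hence outside any relevant homogeneous prime. [folklore; Euler] -/
theorem exists_pderiv_not_mem {ℓ : MvPolynomial (Fin (n + 1)) k} (hℓ1 : ℓ.IsHomogeneous 1) (hℓ0 : ℓ ≠ 0)
    {𝔭 : Ideal (MvPolynomial (Fin (n + 1)) k)} (h𝔭 : 𝔭 ≠ ⊤) : ∃ j : Fin (n + 1), pderiv j ℓ ∉ 𝔭 := by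
  classical
  -- each `∂ℓ/∂x_j` is a constant
  have hC : ∀ j : Fin (n + 1), pderiv j ℓ = C (coeff 0 (pderiv j ℓ)) := by
    intro j
    have h0 : (pderiv j ℓ).totalDegree = 0 :=
      Nat.le_zero.mp (by simpa using (hℓ1.pderiv (i := j)).totalDegree_le)
    exact totalDegree_eq_zero_iff_eq_C.mp h0
  by_contra! h
  -- then every `∂ℓ/∂x_j` vanishes (a non-zero constant is a unit)
  have hz : ∀ j : Fin (n + 1), pderiv j ℓ = 0 := by
    intro j
    by_contra hne
    have hc : coeff 0 (pderiv j ℓ) ≠ 0 := by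
      intro hc; apply hne; rw [hC j, hc, C_0]
    have hu : IsUnit (pderiv j ℓ) := by rw [hC j]; exact (isUnit_iff_ne_zero.mpr hc).map C
    exact h𝔭 (Ideal.eq_top_of_isUnit_mem _ (h j) hu)
  -- Euler: `Σ x_j ∂ℓ/∂x_j = ℓ`
  have hE := hℓ1.sum_X_mul_pderiv
  simp only [hz, mul_zero, Finset.sum_const_zero, one_smul] at hE
  exact hℓ0 hE.symm

end Graded

/-! ## §3 (B6) -/

/-- **(B6) — the Δ2a triple of the key model at `g x₀`.**  At the point `g x₀ ∈ D₊(x_{i₀})`: the stalk of the key model is generated by the germ `Gst` of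
`Gt / x_{i₀}^e`; `Gst ∈ 𝓚_{g x₀}^α` for any `𝓚` with `(Gt)~ ≤ 𝓚^α`; and the image of `Gst` in `𝒪_{ℙ_k, x₀}` (= the germ of `G / x_{i₀}^e`, `G = map θ Gt`) has
order EXACTLY `α`: `∉ 𝔪_{x₀}^{α+1}` — from `G = ℓh^α U + ℓh R₁ + R₂ ℓj` downstairs with `ℓh` linear `∈ 𝔭_{x₀} ∖ 0`, `ℓj ∈ 𝔭_{x₀}` linear, `U ∉ 𝔭_{x₀}`
(possibly inhomogeneous), `Rᵢ ∈ 𝔭_{x₀}^α`.  Statement = res-L1-w45b-stub-4's SIG (B6) verbatim (binders under the statement-level `letI`).  See the module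
docstring for the proof. [OURS · folklore] -/
theorem keyModel_order_at (O : Type) [CommRing O] [IsDomain O] [IsDiscreteValuationRing O] {k : Type} [Field k] [IsAlgClosed k] (θ : O →+* k)
    (_hθ : Function.Surjective θ) {n : ℕ} :
    letI := MvPolynomial.gradedAlgebra (σ := Fin (n + 1)) (R := O)
    letI := MvPolynomial.gradedAlgebra (σ := Fin (n + 1)) (R := k)
    ∀ (φ : homogeneousSubmodule (Fin (n + 1)) O →+*ᵍ homogeneousSubmodule (Fin (n + 1)) k)
    (hφ' : HomogeneousIdeal.irrelevant (homogeneousSubmodule (Fin (n + 1)) k) ≤ (HomogeneousIdeal.irrelevant (homogeneousSubmodule (Fin (n + 1)) O)).map φ)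
    (hφ : ∀ s, φ s = MvPolynomial.map θ s)
    (x₀ : Proj (homogeneousSubmodule (Fin (n + 1)) k)) (i₀ : Fin (n + 1))
    (hx₀i : Proj.map φ hφ' x₀ ∈ Proj.basicOpen (homogeneousSubmodule (Fin (n + 1)) O) (X i₀))
    (Gt : MvPolynomial (Fin (n + 1)) O) (e α : ℕ) (_he : 0 < e) (hGt : Gt ∈ homogeneousSubmodule (Fin (n + 1)) O e)
    -- downstairs shape of `G = map θ Gt`
    (ℓh ℓj G U R₁ R₂ : MvPolynomial (Fin (n + 1)) k) (hG : MvPolynomial.map θ Gt = G)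
    (hℓh1 : ℓh.IsHomogeneous 1) (hℓh0 : ℓh ≠ 0) (hℓhx : ℓh ∈ x₀.asHomogeneousIdeal) (hℓj1 : ℓj.IsHomogeneous 1) (hℓjx : ℓj ∈ x₀.asHomogeneousIdeal)
    (hGeq : G = ℓh ^ α * U + ℓh * R₁ + R₂ * ℓj)
    (hR₁ : R₁ ∈ (x₀.asHomogeneousIdeal).toIdeal ^ α) (hR₂ : R₂ ∈ (x₀.asHomogeneousIdeal).toIdeal ^ α) (hU : U ∉ x₀.asHomogeneousIdeal)
    (𝓚 : (Proj (homogeneousSubmodule (Fin (n + 1)) O)).IdealSheafData)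
    (hle : projIdealSheaf (homogeneousSubmodule (Fin (n + 1)) O)
        ⟨Ideal.span (Set.range fun _ : Fin 1 => Gt), isHomogeneous_span_of_forall_mem _ (fun _ : Fin 1 => Gt) (fun _ => e) (fun _ => hGt)⟩ ≤ 𝓚 ^ α),
    let Gst : (Proj (homogeneousSubmodule (Fin (n + 1)) O)).presheaf.stalk (Proj.map φ hφ' x₀) :=
      ((Proj (homogeneousSubmodule (Fin (n + 1)) O)).presheaf.germ (Proj.basicOpen (homogeneousSubmodule (Fin (n + 1)) O) (X i₀)) _ hx₀i).hom
        ((Proj.awayToSection (homogeneousSubmodule (Fin (n + 1)) O) (X i₀)).hom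
          (mk₁ (homogeneousSubmodule (Fin (n + 1)) O) (CILift.X_mem_one' i₀) e Gt hGt))
    stalkIdeal (projIdealSheaf (homogeneousSubmodule (Fin (n + 1)) O)
        ⟨Ideal.span (Set.range fun _ : Fin 1 => Gt), isHomogeneous_span_of_forall_mem _ (fun _ : Fin 1 => Gt) (fun _ => e) (fun _ => hGt)⟩)
        (Proj.map φ hφ' x₀) = Ideal.span {Gst} ∧
      Gst ∈ stalkIdeal 𝓚 (Proj.map φ hφ' x₀) ^ α ∧
      ((Proj.map φ hφ').stalkMap x₀).hom Gst ∉ maximalIdeal ((Proj (homogeneousSubmodule (Fin (n + 1)) k)).presheaf.stalk x₀) ^ (α + 1) := by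
  letI := MvPolynomial.gradedAlgebra (σ := Fin (n + 1)) (R := O)
  letI := MvPolynomial.gradedAlgebra (σ := Fin (n + 1)) (R := k)
  intro φ hφ' hφ x₀ i₀ hx₀i Gt e α _ hGt ℓh ℓj G U R₁ R₂ hG hℓh1 hℓh0 hℓhx hℓj1 hℓjx hGeq hR₁ hR₂ hU 𝓚 hle Gst
  classical
  -- (1) the stalk generator
  have h1 : stalkIdeal (projIdealSheaf (homogeneousSubmodule (Fin (n + 1)) O)
        ⟨Ideal.span (Set.range fun _ : Fin 1 => Gt), isHomogeneous_span_of_forall_mem _ (fun _ : Fin 1 => Gt) (fun _ => e) (fun _ => hGt)⟩)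
        (Proj.map φ hφ' x₀) = Ideal.span {Gst} := by
    rw [CILift.stalkIdeal_projIdealSheaf_span (fun _ : Fin 1 => Gt) (fun _ => e) (fun _ => hGt) i₀ _ hx₀i, Set.range_const]
  refine ⟨h1, ?_, ?_⟩
  · -- (2) gauge membership
    rw [← stalkIdeal_pow]
    exact stalkIdeal_mono hle _ (h1 ▸ Ideal.mem_span_singleton_self Gst)
  -- (3) ORDER EXACTLY `α` downstairs — inside the regular local ring `S = 𝒪_{ℙⁿ_k, x₀}`
  have hφX : φ (X i₀) = X i₀ := by rw [hφ, MvPolynomial.map_X]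
  have hx₀k : x₀ ∈ Proj.basicOpen (homogeneousSubmodule (Fin (n + 1)) k) (X i₀) := by
    have h : x₀ ∈ (Proj.map φ hφ') ⁻¹ᵁ Proj.basicOpen (homogeneousSubmodule (Fin (n + 1)) O) (X i₀) := hx₀i
    rwa [Proj.map_preimage_basicOpen, hφX] at h
  haveI hreg : IsRegularLocalRing ((Proj (homogeneousSubmodule (Fin (n + 1)) k)).presheaf.stalk x₀) :=
    isRegular_projectiveSpace n k x₀
  -- the dehomogenisation-germ ring map `γ : k[x] → S`
  let γ : MvPolynomial (Fin (n + 1)) k →+* ((Proj (homogeneousSubmodule (Fin (n + 1)) k)).presheaf.stalk x₀ : CommRingCat) :=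
    ((Proj (homogeneousSubmodule (Fin (n + 1)) k)).presheaf.germ
        (Proj.basicOpen (homogeneousSubmodule (Fin (n + 1)) k) (X i₀)) x₀ hx₀k).hom.comp
      ((Proj.awayToSection (homogeneousSubmodule (Fin (n + 1)) k) (X i₀)).hom.comp
        (MvPolynomial.eval₂Hom (Literature.AlgebraicGeometry.Motives.Segre.cst k (X i₀))
          (Literature.AlgebraicGeometry.Motives.Segre.frac k i₀)))
  have hγ : ∀ (d : ℕ) (F : MvPolynomial (Fin (n + 1)) k) (hF : F ∈ homogeneousSubmodule (Fin (n + 1)) k d),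
      γ F = ((Proj (homogeneousSubmodule (Fin (n + 1)) k)).presheaf.germ
          (Proj.basicOpen (homogeneousSubmodule (Fin (n + 1)) k) (X i₀)) x₀ hx₀k).hom
        ((Proj.awayToSection (homogeneousSubmodule (Fin (n + 1)) k) (X i₀)).hom
          (mk₁ (homogeneousSubmodule (Fin (n + 1)) k) (CILift.X_mem_one' i₀) d F hF)) := by
    intro d F hF
    simp only [γ, RingHom.comp_apply]
    rw [DetLift.mk₁_eq_eval₂Hom_frac]
  have hγmem : ∀ (d : ℕ) (F : MvPolynomial (Fin (n + 1)) k) (hF : F ∈ homogeneousSubmodule (Fin (n + 1)) k d),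
      γ F ∈ maximalIdeal _ ↔ F ∈ x₀.asHomogeneousIdeal := by
    intro d F hF
    rw [hγ d F hF]
    exact CILift.germ_mk₁_mem_maximalIdeal_iff i₀ x₀ hx₀k d F hF
  -- `γ(𝔭) ⊆ 𝔪` (𝔭 homogeneous: piece by piece), hence `γ(𝔭^m) ⊆ 𝔪^m`
  have hγ𝔭 : ∀ r ∈ x₀.asHomogeneousIdeal.toIdeal, γ r ∈ maximalIdeal _ := by
    intro r hr
    rw [← DirectSum.sum_support_decompose (homogeneousSubmodule (Fin (n + 1)) k) r, map_sum]
    exact Ideal.sum_mem _ fun i _ => (hγmem i _ (SetLike.coe_mem _)).mpr (x₀.asHomogeneousIdeal.isHomogeneous i hr)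
  have hγpow : ∀ (m : ℕ) (r : MvPolynomial (Fin (n + 1)) k), r ∈ x₀.asHomogeneousIdeal.toIdeal ^ m → γ r ∈ maximalIdeal _ ^ m := by
    intro m r hr
    have h := Ideal.mem_map_of_mem γ hr
    rw [Ideal.map_pow] at h
    have hmaple : Ideal.map γ x₀.asHomogeneousIdeal.toIdeal ≤ maximalIdeal _ :=
      Ideal.map_le_of_le_comap fun r' hr' => Ideal.mem_comap.mpr (hγ𝔭 r' hr')
    exact Ideal.pow_right_mono hmaple m h
  -- powers of `𝔭` are homogeneous ideals
  have hhom : ∀ m : ℕ, (x₀.asHomogeneousIdeal.toIdeal ^ m).IsHomogeneous (homogeneousSubmodule (Fin (n + 1)) k) := by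
    intro m
    induction m with
    | zero =>
      rw [pow_zero, Ideal.one_eq_top, ← HomogeneousIdeal.toIdeal_top (𝒜 := homogeneousSubmodule (Fin (n + 1)) k)]
      exact (⊤ : HomogeneousIdeal (homogeneousSubmodule (Fin (n + 1)) k)).isHomogeneous
    | succ m ih =>
      rw [pow_succ]
      exact ih.mul x₀.asHomogeneousIdeal.isHomogeneous
  -- `t = γ ℓh ∈ 𝔪 ∖ 𝔪²`
  have hℓh1' : ℓh ∈ homogeneousSubmodule (Fin (n + 1)) k 1 := hℓh1
  have hℓj1' : ℓj ∈ homogeneousSubmodule (Fin (n + 1)) k 1 := hℓj1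
  have ht1 : γ ℓh ∈ maximalIdeal _ := (hγmem 1 ℓh hℓh1').mpr hℓhx
  have ht2 : γ ℓh ∉ maximalIdeal _ ^ 2 := by
    intro h
    obtain ⟨j₀, hj₀⟩ := exists_pderiv_not_mem hℓh1 hℓh0 (𝔭 := x₀.asHomogeneousIdeal.toIdeal) x₀.isPrime.ne_top
    have hjac : ∃ em : Fin 1 ↪ Fin (n + 1),
        (Matrix.of fun i j => pderiv (em j) ((fun _ : Fin 1 => ℓh) i)).det ∉ x₀.asHomogeneousIdeal := by
      refine ⟨⟨fun _ => j₀, Function.injective_of_subsingleton _⟩, ?_⟩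
      rw [Matrix.det_unique, Matrix.of_apply]
      exact hj₀
    have key := CILift.downstairs_stalk_of_jacobian (fun _ : Fin 1 => ℓh) (fun _ => 1) (fun _ => hℓh1') x₀ (fun _ => hℓhx)
      hjac i₀ hx₀k (fun _ => 1) (by simpa only [Fin.sum_univ_one, one_mul, ← hγ 1 ℓh hℓh1'] using h) 0
    exact (maximalIdeal.isMaximal _).ne_top (Ideal.eq_top_of_isUnit_mem _ key isUnit_one)
  -- a graded piece of `U` outside `𝔭`: its germ is a UNIT
  obtain ⟨d₀, hd₀⟩ : ∃ d₀ : ℕ,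
      ((DirectSum.decompose (homogeneousSubmodule (Fin (n + 1)) k) U d₀ : MvPolynomial (Fin (n + 1)) k)) ∉ x₀.asHomogeneousIdeal := by
    by_contra! h
    apply hU
    rw [← DirectSum.sum_support_decompose (homogeneousSubmodule (Fin (n + 1)) k) U]
    exact Ideal.sum_mem _ fun i _ => h i
  have hunit : IsUnit (γ (DirectSum.decompose (homogeneousSubmodule (Fin (n + 1)) k) U d₀ : MvPolynomial (Fin (n + 1)) k)) := by
    by_contra hnu
    exact hd₀ ((hγmem d₀ _ (SetLike.coe_mem _)).mp ((mem_maximalIdeal _).mpr (mem_nonunits_iff.mpr hnu)))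
  -- homogeneity data
  have hℓhα : ℓh ^ α ∈ homogeneousSubmodule (Fin (n + 1)) k α := by
    simpa [mem_homogeneousSubmodule] using hℓh1.pow α
  have hGe : G ∈ homogeneousSubmodule (Fin (n + 1)) k e := by
    rw [← hG, ← hφ]; exact φ.map_mem hGt
  -- the degree-`(α + d₀)` piece of the identity
  have hpiece : ((DirectSum.decompose (homogeneousSubmodule (Fin (n + 1)) k) G (α + d₀) : MvPolynomial (Fin (n + 1)) k)) =
      ℓh ^ α * (DirectSum.decompose (homogeneousSubmodule (Fin (n + 1)) k) U d₀ : MvPolynomial (Fin (n + 1)) k) +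
        (DirectSum.decompose (homogeneousSubmodule (Fin (n + 1)) k) (ℓh * R₁) (α + d₀) : MvPolynomial (Fin (n + 1)) k) +
        (DirectSum.decompose (homogeneousSubmodule (Fin (n + 1)) k) (R₂ * ℓj) (α + d₀) : MvPolynomial (Fin (n + 1)) k) := by
    have h := congrArg (GradedRing.proj (homogeneousSubmodule (Fin (n + 1)) k) (α + d₀)) hGeq
    simp only [map_add, GradedRing.proj_apply] at h
    rw [h, DirectSum.coe_decompose_mul_add_of_left_mem (homogeneousSubmodule (Fin (n + 1)) k) hℓhα]
  have hA : γ (DirectSum.decompose (homogeneousSubmodule (Fin (n + 1)) k) (ℓh * R₁) (α + d₀) : MvPolynomial (Fin (n + 1)) k) ∈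
      maximalIdeal _ ^ (α + 1) := by
    rw [DirectSum.coe_decompose_mul_of_left_mem (homogeneousSubmodule (Fin (n + 1)) k) (α + d₀) hℓh1']
    split_ifs with hle1
    · rw [map_mul, pow_succ']
      exact Ideal.mul_mem_mul ht1 (hγpow α _ (hhom α _ hR₁))
    · rw [map_zero]; exact zero_mem _
  have hB : γ (DirectSum.decompose (homogeneousSubmodule (Fin (n + 1)) k) (R₂ * ℓj) (α + d₀) : MvPolynomial (Fin (n + 1)) k) ∈
      maximalIdeal _ ^ (α + 1) := by
    rw [DirectSum.coe_decompose_mul_of_right_mem (homogeneousSubmodule (Fin (n + 1)) k) (α + d₀) hℓj1']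
    split_ifs with hle1
    · rw [map_mul, pow_succ]
      exact Ideal.mul_mem_mul (hγpow α _ (hhom α _ hR₂)) ((hγmem 1 ℓj hℓj1').mpr hℓjx)
    · rw [map_zero]; exact zero_mem _
  have hmain : γ (DirectSum.decompose (homogeneousSubmodule (Fin (n + 1)) k) G (α + d₀) : MvPolynomial (Fin (n + 1)) k) ∉
      maximalIdeal _ ^ (α + 1) := by
    rw [hpiece, map_add, map_add, map_mul, map_pow, add_assoc]
    exact pow_mul_unit_add_not_mem_pow_succ ht2 hunit α (add_mem hA hB)
  -- hence `α + d₀ = e` and `γ G ∉ 𝔪^{α+1}`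
  have hγG : γ G ∉ maximalIdeal _ ^ (α + 1) := by
    by_cases hd : e = α + d₀
    · rw [← DirectSum.decompose_of_mem_same (ℳ := homogeneousSubmodule (Fin (n + 1)) k) hGe, hd]
      exact hmain
    · exfalso
      apply hmain
      rw [DirectSum.decompose_of_mem_ne (ℳ := homogeneousSubmodule (Fin (n + 1)) k) hGe hd, map_zero]
      exact zero_mem _
  -- transport to the `O`-germ `Gst` along the stalk map of `g`
  have hGst : ((Proj.map φ hφ').stalkMap x₀).hom Gst = γ G := by
    rw [hγ e G hGe]
    exact CILift.stalkMap_germ_mk₁ O φ hφ' i₀ hφX e Gt hGt G hGe (by rw [hφ, hG]) x₀ hx₀k hx₀i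
  rw [hGst]
  exact hγG

end KeyForm

end Summit.ResolutionOfSingularities.ResolutionOfSingularities.Cruxes.EquisingularLiftNat.Sections

end
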